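import Summits.QuantumFields.BalabanUV.T4Continuum.Support.AveragingDeficitPlaqDeriv
import Summits.QuantumFields.BalabanUV.T4Continuum.Support.AveragingDeficitDerivCore

/-!
# AveragingDeficitPlaqLin (T⁴ programme, node NE3, row NE3-R2) — THE DERIVATIVE-LEVEL LINEARISATION (DL) of Bałaban's
# average: in a region where every bond variable is within `β` of `1` (the axial gauge of B7 p. 24), the derivative
# `Ω_P` of the coarse plaquette variable along `V e^{sψ}` is the STENCIL AVERAGE OF THE DRESSED CURL,
# `Ω⁰_P = L^{−d}Σ_k (d_Vψ)(p_k)`, up to `C(d,L)·β·‖ψ‖_{ℓ¹(box)}` — via the abelian contour functional, the tree's corner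
# cancellation and Stokes formula (B7 (48)), and «the product over `b` replaced by the sum» (B7 p. 28)

HONEST FRAMING, CITATION HEADER, PLACEMENT: as in `AveragingDeficitDerivCore` (unit `b2b-balaban-t4-ne3r2-p1`, row NE3-R2;
β = `DeficitDerivWall` NOT proved here — this is layer (DL), part 3; [folklore] matrix bookkeeping on the tree's (42)/(44)/
(48); `[cite:]` tags are CONTEXT; NE3 COND-free; finite-T⁴ rung (B)+1, not Clay).
WHAT IS PROVED.  §1 region bookkeeping (`RegionBound`: `‖V(b) − 1‖ ≤ β` for bonds within `ℓ¹`-distance `R₁ = (2d+4)L+4`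
of the corner `z`; `lnorm_le_region`, `norm_Wcx_sub_one_le_region`, `loopAvg_le_region`, `norm_dhol_seg_le_region`).
§2 the abelian side functional `abLin = Σ_x L^{−d}ψ(Γ_{c,x})` and `norm_sideDerivLin_sub_abLin_le`; §3 THE ALGEBRA:
`omegaAb` (= `Σ± abLin_i`) **equals** `L^{−d}Σ_k ψ(∂p_k)` over the stencil (`omegaAb_eq_stencil`: `sum_weights`,
`corner_cancellation`, `stokes`); §4 `omegaLin = L^{−d}Σ_k (d_Vψ)(p_k)`, `norm_omegaAb_sub_omegaLin_le`; the assembled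
bound `‖Ω_P − Ω⁰_P‖ ≤ plaqLinConst d L · β · ‖ψ‖_{ℓ¹(box R₁ z)}` is file `AveragingDeficitPlaqLinBound` (split for the 400-line
rule).  Record: HOME `t4/T4-EST-NE3-R2.md`.
-/

set_option autoImplicit false

open scoped BigOperators Matrix Matrix.Norms.L2Operator Topology
open NormedSpace Finset Filter

namespace Summit.QuantumFields.BalabanUV.T4Continuum.AveragingDeficitPlaqLin

open Literature.MathematicalPhysics.QuantumFieldTheory.Balaban1983to89
open B7Prop1Explicit B7Prop2Explicit MatrixLog UnitaryModel
open T4AveragingDeficitWall hiding Site Plane Plaq Bond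
open T4AveragingDeficitWallBoundary (stencilIdx stencilOff card_stencilIdx)
open T4AveragingDeficitNonAbelian (Ad_mul Ad_sub)
open AveragingDeficitTransport AveragingDeficitLocality AveragingDeficitNearIdentity AveragingDeficitCounting
open AveragingDeficitSideDeriv AveragingDeficitPlaqDeriv AveragingDeficitDerivCore

noncomputable section

variable {d : ℕ} {n : Type*} [Fintype n] [DecidableEq n]

local notation "𝕄" => Matrix n n ℂ
local notation "Site" => B7Prop1Explicit.Site

/-! ## §1 The region: all bond variables within `ℓ¹`-distance `R₁` of the corner are within `β` of `1` -/

/-- The `ℓ¹` reach of everything the derivative of one coarse plaquette sees. [folklore] -/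
def reach (d L : ℕ) : ℕ := (2 * d + 4) * L + 4

/-- Linear consequences of the definition of `reach` (for `omega`, which does not see products). [folklore] -/
theorem reach_ge (d L : ℕ) :
    (2 * d + 2) * L + L + 4 ≤ reach d L ∧ (d + 2) * L + 4 ≤ reach d L ∧ 2 * L + 4 ≤ reach d L := by
  unfold reach; refine ⟨?_, ?_, ?_⟩ <;> nlinarith

/-- `RegionBound V z R β`: every bond starting within `ℓ¹`-distance `R` of `z` is within `β` of `1`. [folklore] -/
def RegionBound (V : Site d → Fin d → 𝕄ˣ) (z : Site d) (R : ℕ) (β : ℝ) : Prop :=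
  ∀ (x : Site d) (κ : Fin d), l1 (x - z) ≤ R → ‖((V x κ : 𝕄ˣ) : 𝕄) - 1‖ ≤ β

omit [Fintype n] [DecidableEq n] in
/-- `l1`-closeness gives box membership. [folklore] -/
theorem mem_box_of_l1 {R : ℕ} {x z : Site d} (h : l1 (x - z) ≤ R) : x ∈ box R z := by
  refine mem_box_iff.mpr fun κ => ?_
  have h1 : ((x - z) κ).natAbs ≤ l1 (x - z) :=
    Finset.single_le_sum (f := fun κ => ((x - z) κ).natAbs) (fun _ _ => Nat.zero_le _) (Finset.mem_univ κ)
  have h2 : |(x - z) κ| = (((x - z) κ).natAbs : ℤ) := (Int.natCast_natAbs _).symm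
  rw [show x κ - z κ = (x - z) κ from rfl, h2]
  exact_mod_cast h1.trans h

/-- `‖ψ‖_{ℓ¹(box)}` as a sum over the bond set `box × directions`. [folklore] -/
theorem dirL1_eq_sum_prod (ψ : Site d → Fin d → 𝕄) (B : Finset (Site d)) :
    dirL1 ψ B = ∑ b ∈ B ×ˢ (Finset.univ : Finset (Fin d)), ‖ψ b.1 b.2‖ := by
  unfold T4AveragingDeficitWall.dirL1; rw [Finset.sum_product]

/-- **A word sum against the box sum**: if `l1(q − z) + |Γ| ≤ R`, then `Σ_{b⊂Γ}‖ψ(b)‖ ≤ |Γ| · ‖ψ‖_{ℓ¹(box R z)}`. [folklore] -/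
theorem lnorm_le_region (ψ : Site d → Fin d → 𝕄) {z q : Site d} {R : ℕ} (w : List (Letter d))
    (hq : l1 (q - z) + w.length ≤ R) : lnorm ψ q w ≤ w.length * dirL1 ψ (box R z) := by
  rw [dirL1_eq_sum_prod]
  refine lnorm_le_length_mul_sum ψ _ q w fun b hb => Finset.mem_product.mpr ⟨mem_box_of_l1 ?_, Finset.mem_univ _⟩
  have h1 := l1_le_of_mem_bondsOf q w b hb
  have h2 := l1_add_le (b.1 - q) (q - z)
  rw [show b.1 - q + (q - z) = b.1 - z by abel] at h2
  omega

/-- `|loop_{c,x}| ≤ (2d+2)L` for `x` in the block. [folklore] -/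
theorem length_loopWord_le (L : ℕ) (κ : Fin d) (r : Fin d → Fin L) :
    (loopWord L κ (boxVec L r)).length ≤ (2 * d + 2) * L := by
  rw [length_loopWord]
  have := l1_boxVec_le L r
  nlinarith

/-- **The loop variables of a side are within `(2d+2)L·β` of `1`** in the region (`l1(q − z) ≤ L`). [folklore] -/
theorem norm_Wcx_sub_one_le_region [Nonempty n] (L : ℕ) {V : Site d → Fin d → 𝕄ˣ} (hV : IsUnitaryCfg V) {z q : Site d}
    {β : ℝ} (hR : RegionBound V z (reach d L) β) (hq : l1 (q - z) ≤ L) (κ : Fin d) (r : Fin d → Fin L) :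
    ‖((Wcx L V q κ (boxVec L r) : 𝕄ˣ) : 𝕄) - 1‖ ≤ (2 * d + 2) * L * β := by
  have hβ : 0 ≤ β := (norm_nonneg _).trans (hR z κ (by simp [l1]))
  rw [Wcx_eq_hol_loop]
  have hlen := length_loopWord_le L κ r
  refine (norm_hol_sub_one_le_of_bonds hV q _ fun b hb => hR b.1 b.2 ?_).trans ?_
  · have h1 := l1_le_of_mem_bondsOf q _ b hb
    have h2 := l1_add_le (b.1 - q) (q - z)
    rw [show b.1 - q + (q - z) = b.1 - z by abel] at h2
    have h3 := (reach_ge d L).1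
    rw [loopWord] at hlen; omega
  · rw [← loopWord]
    exact mul_le_mul_of_nonneg_right (by exact_mod_cast hlen) hβ

/-- `loopAvg ≤ (2d+2)L · ‖ψ‖_{ℓ¹(box)}` in the region. [folklore] -/
theorem loopAvg_le_region [Nonempty n] (L : ℕ) (hL : 1 ≤ L) {V : Site d → Fin d → 𝕄ˣ} (hV : IsUnitaryCfg V)
    (ψ : Site d → Fin d → 𝕄) {z q : Site d} (hq : l1 (q - z) ≤ L) (κ : Fin d) :
    loopAvg L V ψ q κ ≤ (2 * d + 2) * L * dirL1 ψ (box (reach d L) z) := by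
  unfold loopAvg
  have hS := dirL1_nonneg ψ (box (reach d L) z)
  have key : ∀ r : Fin d → Fin L, ‖dhol V ψ q (loopWord L κ (boxVec L r))‖ ≤ (2 * d + 2) * L * dirL1 ψ (box (reach d L) z) := by
    intro r
    have hlen := length_loopWord_le L κ r
    have h3 := (reach_ge d L).1
    refine (norm_dhol_le hV ψ q _).trans ((lnorm_le_region ψ (z := z) (q := q) (R := reach d L) _ (by omega)).trans ?_)
    exact mul_le_mul_of_nonneg_right (by exact_mod_cast hlen) hS
  calc ∑ r : Fin d → Fin L, ((L : ℝ) ^ d)⁻¹ * ‖dhol V ψ q (loopWord L κ (boxVec L r))‖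
      ≤ ∑ _r : Fin d → Fin L, ((L : ℝ) ^ d)⁻¹ * ((2 * d + 2) * L * dirL1 ψ (box (reach d L) z)) :=
        Finset.sum_le_sum fun r _ => mul_le_mul_of_nonneg_left (key r) (by positivity)
    _ = (2 * d + 2) * L * dirL1 ψ (box (reach d L) z) := by rw [← Finset.sum_mul, sum_weights L hL, one_mul]

/-- `‖(δ_ψV)(Γ_c)‖ ≤ L · ‖ψ‖_{ℓ¹(box)}` in the region. [folklore] -/
theorem norm_dhol_seg_le_region [Nonempty n] (L : ℕ) {V : Site d → Fin d → 𝕄ˣ} (hV : IsUnitaryCfg V)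
    (ψ : Site d → Fin d → 𝕄) {z q : Site d} (hq : l1 (q - z) ≤ L) (κ : Fin d) :
    ‖dhol V ψ q (seg κ L)‖ ≤ L * dirL1 ψ (box (reach d L) z) := by
  have h3 := (reach_ge d L).2.2
  have hlen : (seg κ (L : ℤ)).length = L := by rw [length_seg, Int.natAbs_natCast]
  refine (norm_dhol_le hV ψ q _).trans ((lnorm_le_region ψ (z := z) (q := q) (R := reach d L) _ (by omega)).trans (le_of_eq ?_))
  rw [hlen]

/-! ## §2 The abelian side functional -/

/-- The linearised side derivative with the dressings dropped: `Σ_x L^{−d} ψ(loop_{c,x}) + ψ(Γ_c)`, `ψ(Γ) = asum`.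
[cite: Balaban1985Averaging, p.28] -/
def abLin (L : ℕ) (ψ : Site d → Fin d → 𝕄) (q : Site d) (κ : Fin d) : 𝕄 :=
  ∑ r : Fin d → Fin L, (((L : ℝ) ^ d)⁻¹) • asum ψ q (loopWord L κ (boxVec L r)) + asum ψ q (seg κ L)

/-- **B7 p. 28's `Q₀`: the abelian side functional is the contour average `Σ_x L^{−d} ψ(Γ_{c,x})`** (the `ψ(Γ_c)` terms
cancel by `Σ_x L^{−d} = 1`). [cite: Balaban1985Averaging, p.28] -/
theorem abLin_eq (L : ℕ) (hL : 1 ≤ L) (ψ : Site d → Fin d → 𝕄) (q : Site d) (κ : Fin d) :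
    abLin L ψ q κ = ∑ r : Fin d → Fin L, (((L : ℝ) ^ d)⁻¹) • asum ψ q (gammaWord L κ (boxVec L r)) := by
  unfold abLin
  have hloop : ∀ r : Fin d → Fin L, asum ψ q (loopWord L κ (boxVec L r))
      = asum ψ q (gammaWord L κ (boxVec L r)) - asum ψ q (seg κ L) := by
    intro r
    rw [loopWord, asum_append, disp_gammaWord, asum_seg_neg, add_sub_cancel_right, sub_eq_add_neg]
  simp only [hloop, smul_sub, Finset.sum_sub_distrib, ← Finset.sum_smul, sum_weights L hL, one_smul, sub_add_cancel]

/-- **The dressings cost `O(|Γ|β)`**: `‖sideDerivLin − abLin‖ ≤ 2((2d+2)L)²β·S + 2L²β·S`, `S = ‖ψ‖_{ℓ¹(box)}`.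
[cite: Balaban1985Averaging, p.28] -/
theorem norm_sideDerivLin_sub_abLin_le [Nonempty n] (L : ℕ) (hL : 1 ≤ L) {V : Site d → Fin d → 𝕄ˣ} (hV : IsUnitaryCfg V)
    (ψ : Site d → Fin d → 𝕄) {z q : Site d} {β : ℝ} (hR : RegionBound V z (reach d L) β) (hq : l1 (q - z) ≤ L)
    (κ : Fin d) :
    ‖sideDerivLin L V ψ q κ - abLin L ψ q κ‖
      ≤ (2 * ((2 * d + 2) * L) ^ 2 + 2 * (L : ℝ) ^ 2) * β * dirL1 ψ (box (reach d L) z) := by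
  have hβ : 0 ≤ β := (norm_nonneg _).trans (hR z κ (by simp [l1]))
  have hS := dirL1_nonneg ψ (box (reach d L) z)
  unfold sideDerivLin abLin
  rw [add_sub_add_comm, ← Finset.sum_sub_distrib]
  refine (norm_add_le _ _).trans ?_
  have h1 : ‖∑ r : Fin d → Fin L, ((((L : ℝ) ^ d)⁻¹) • dhol V ψ q (loopWord L κ (boxVec L r))
        - (((L : ℝ) ^ d)⁻¹) • asum ψ q (loopWord L κ (boxVec L r)))‖
      ≤ 2 * ((2 * d + 2) * L) ^ 2 * β * dirL1 ψ (box (reach d L) z) := by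
    simp only [← smul_sub]
    refine norm_avg_le L hL _ fun r => ?_
    have hlen := length_loopWord_le L κ r
    have h3 := (reach_ge d L).1
    have hreg : ∀ (x' : Site d) (κ' : Fin d), l1 (x' - q) ≤ (loopWord L κ (boxVec L r)).length →
        ‖((V x' κ' : 𝕄ˣ) : 𝕄) - 1‖ ≤ β := by
      intro x' κ' hx'
      refine hR x' κ' ?_
      have h2 := l1_add_le (x' - q) (q - z)
      rw [show x' - q + (q - z) = x' - z by abel] at h2
      omega
    refine (norm_dhol_sub_asum_le_of_l1 hV ψ hβ q _ hreg).trans ?_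
    have hl := lnorm_le_region ψ (z := z) (q := q) (R := reach d L) (loopWord L κ (boxVec L r)) (by omega)
    have hlen' : ((loopWord L κ (boxVec L r)).length : ℝ) ≤ (2 * d + 2) * L := by exact_mod_cast hlen
    calc 2 * ((loopWord L κ (boxVec L r)).length : ℝ) * β * lnorm ψ q (loopWord L κ (boxVec L r))
        ≤ 2 * ((2 * d + 2) * L) * β * (((2 * d + 2) * L) * dirL1 ψ (box (reach d L) z)) := by
          refine mul_le_mul (mul_le_mul_of_nonneg_right (mul_le_mul_of_nonneg_left hlen' (by norm_num)) hβ)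
            (hl.trans (mul_le_mul_of_nonneg_right hlen' hS)) (lnorm_nonneg ψ q _) (by positivity)
      _ = 2 * ((2 * d + 2) * L) ^ 2 * β * dirL1 ψ (box (reach d L) z) := by ring
  have h2 : ‖dhol V ψ q (seg κ L) - asum ψ q (seg κ L)‖ ≤ 2 * (L : ℝ) ^ 2 * β * dirL1 ψ (box (reach d L) z) := by
    have hlen : (seg κ (L : ℤ)).length = L := by rw [length_seg, Int.natAbs_natCast]
    have h3 := (reach_ge d L).2.2
    have hreg : ∀ (x' : Site d) (κ' : Fin d), l1 (x' - q) ≤ (seg κ (L : ℤ)).length →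
        ‖((V x' κ' : 𝕄ˣ) : 𝕄) - 1‖ ≤ β := by
      intro x' κ' hx'
      refine hR x' κ' ?_
      have h2 := l1_add_le (x' - q) (q - z)
      rw [show x' - q + (q - z) = x' - z by abel] at h2
      omega
    refine (norm_dhol_sub_asum_le_of_l1 hV ψ hβ q _ hreg).trans ?_
    have hl := lnorm_le_region ψ (z := z) (q := q) (R := reach d L) (seg κ (L : ℤ)) (by omega)
    rw [hlen] at hl ⊢
    calc 2 * (L : ℝ) * β * lnorm ψ q (seg κ L) ≤ 2 * (L : ℝ) * β * (L * dirL1 ψ (box (reach d L) z)) :=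
          mul_le_mul_of_nonneg_left hl (by positivity)
      _ = 2 * (L : ℝ) ^ 2 * β * dirL1 ψ (box (reach d L) z) := by ring
  calc _ ≤ _ := add_le_add h1 h2
    _ = _ := by ring

/-! ## §3 The algebra: corner cancellation and Stokes turn the four abelian sides into the stencil average of the curl -/

/-- The abelian `Ω`: `abLin(z,μ) + abLin(z+Le_μ,ν) − abLin(z+Le_ν,μ) − abLin(z,ν)`. [folklore] -/
def omegaAb (L : ℕ) (ψ : Site d → Fin d → 𝕄) (z : Site d) (μ ν : Fin d) : 𝕄 :=
  abLin L ψ z μ + abLin L ψ (z + (L : ℤ) • e μ) ν - abLin L ψ (z + (L : ℤ) • e ν) μ - abLin L ψ z ν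

omit [Fintype n] [DecidableEq n] in
/-- Flattening a matrix-valued stencil sum. [folklore] -/
theorem sum_stencilIdx_eq' (L : ℕ) (Ψ : (Fin d → Fin L) → ℕ → ℕ → 𝕄) :
    ∑ k ∈ stencilIdx d L, Ψ k.1 k.2.1 k.2.2
      = ∑ r : Fin d → Fin L, ∑ i ∈ Finset.range L, ∑ j ∈ Finset.range L, Ψ r i j := by
  unfold stencilIdx
  rw [Finset.sum_product]
  refine Finset.sum_congr rfl fun r _ => ?_
  rw [Finset.sum_product]

/-- **THE LINEARISED DERIVATIVE OF THE COARSE PLAQUETTE VARIABLE IS THE STENCIL AVERAGE OF THE ABELIAN CURL**: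
`omegaAb = L^{−d} Σ_{k ∈ stencil} ψ(∂p_k)` — B7 (48): corner cancellation + Stokes, with `Σ_x L^{−d} = 1`.
[cite: Balaban1985Averaging, (48) p.25, p.28] -/
theorem omegaAb_eq_stencil (L : ℕ) (hL : 1 ≤ L) (ψ : Site d → Fin d → 𝕄) (z : Site d) (μ ν : Fin d) :
    omegaAb L ψ z μ ν
      = ∑ k ∈ stencilIdx d L, (((L : ℝ) ^ d)⁻¹) • asum ψ (z + stencilOff L μ ν k) (plaqWord μ ν) := by
  unfold omegaAb
  simp only [abLin_eq L hL]
  rw [← Finset.sum_add_distrib, ← Finset.sum_sub_distrib, ← Finset.sum_sub_distrib]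
  have hR : ∑ k ∈ stencilIdx d L, (((L : ℝ) ^ d)⁻¹) • asum ψ (z + stencilOff L μ ν k) (plaqWord μ ν)
      = ∑ r : Fin d → Fin L, ∑ i ∈ Finset.range L, ∑ j ∈ Finset.range L,
          (((L : ℝ) ^ d)⁻¹) • asum ψ (z + boxVec L r + (i : ℤ) • e μ + (j : ℤ) • e ν) (plaqWord μ ν) := by
    rw [← sum_stencilIdx_eq' L (fun r i j =>
      (((L : ℝ) ^ d)⁻¹) • asum ψ (z + boxVec L r + (i : ℤ) • e μ + (j : ℤ) • e ν) (plaqWord μ ν))]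
    refine Finset.sum_congr rfl fun k _ => ?_
    simp only [stencilOff, add_assoc]
  rw [hR]
  refine Finset.sum_congr rfl fun r _ => ?_
  rw [← smul_add, ← smul_sub, ← smul_sub, corner_cancellation, stokes, Finset.smul_sum]
  refine Finset.sum_congr rfl fun i _ => ?_
  rw [Finset.smul_sum]

/-! ## §4 The stencil average of the DRESSED curl -/

/-- `Ω⁰_P := L^{−d} Σ_{k ∈ stencil} (d_Vψ)(p_k)`. [folklore] -/
def omegaLin (L : ℕ) (V : Site d → Fin d → 𝕄ˣ) (ψ : Site d → Fin d → 𝕄) (z : Site d) (μ ν : Fin d) : 𝕄 :=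
  ∑ k ∈ stencilIdx d L, (((L : ℝ) ^ d)⁻¹) • curlAt V ψ (z + stencilOff L μ ν k) μ ν

/-- `l1` of a stencil offset is at most `(d+2)L`. [folklore] -/
theorem l1_stencilOff_le (L : ℕ) (μ ν : Fin d) {k : (Fin d → Fin L) × (ℕ × ℕ)} (hk : k ∈ stencilIdx d L) :
    l1 (stencilOff L μ ν k) ≤ (d + 2) * L := by
  have hi : k.2.1 < L := by
    have := (Finset.mem_product.mp (Finset.mem_product.mp hk).2).1; simpa using this
  have hj : k.2.2 < L := by
    have := (Finset.mem_product.mp (Finset.mem_product.mp hk).2).2; simpa using this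
  unfold stencilOff
  calc l1 (boxVec L k.1 + (k.2.1 : ℤ) • e μ + (k.2.2 : ℤ) • e ν)
      ≤ l1 (boxVec L k.1 + (k.2.1 : ℤ) • e μ) + l1 ((k.2.2 : ℤ) • (e ν : Site d)) := l1_add_le _ _
    _ ≤ l1 (boxVec L k.1) + l1 ((k.2.1 : ℤ) • (e μ : Site d)) + l1 ((k.2.2 : ℤ) • (e ν : Site d)) :=
        add_le_add (l1_add_le _ _) le_rfl
    _ ≤ d * L + L + L := by
        rw [l1_zsmul_e, l1_zsmul_e, Int.natAbs_natCast, Int.natAbs_natCast]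
        have := l1_boxVec_le L k.1
        omega
    _ = (d + 2) * L := by ring

/-- **Abelian vs dressed curl on the stencil**: `‖omegaAb − Ω⁰‖ ≤ 32L²β·‖ψ‖_{ℓ¹(box)}`. [folklore] -/
theorem norm_omegaAb_sub_omegaLin_le [Nonempty n] (L : ℕ) (hL : 1 ≤ L) {V : Site d → Fin d → 𝕄ˣ} (hV : IsUnitaryCfg V)
    (ψ : Site d → Fin d → 𝕄) {z : Site d} {β : ℝ} (hR : RegionBound V z (reach d L) β) (μ ν : Fin d) :
    ‖omegaAb L ψ z μ ν - omegaLin L V ψ z μ ν‖ ≤ 32 * (L : ℝ) ^ 2 * β * dirL1 ψ (box (reach d L) z) := by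
  have hβ : 0 ≤ β := (norm_nonneg _).trans (hR z μ (by simp [l1]))
  have hS := dirL1_nonneg ψ (box (reach d L) z)
  rw [omegaAb_eq_stencil L hL]
  unfold omegaLin
  rw [← Finset.sum_sub_distrib]
  have key : ∀ k ∈ stencilIdx d L, ‖(((L : ℝ) ^ d)⁻¹) • asum ψ (z + stencilOff L μ ν k) (plaqWord μ ν)
        - (((L : ℝ) ^ d)⁻¹) • curlAt V ψ (z + stencilOff L μ ν k) μ ν‖
      ≤ ((L : ℝ) ^ d)⁻¹ * (32 * β * dirL1 ψ (box (reach d L) z)) := by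
    intro k hk
    rw [← smul_sub, norm_smul, Real.norm_of_nonneg (by positivity), norm_sub_rev, ← dhol_plaqWord]
    refine mul_le_mul_of_nonneg_left ?_ (by positivity)
    have hoff := l1_stencilOff_le L μ ν hk
    have hlen : (plaqWord μ ν : List (Letter d)).length = 4 := rfl
    have h3 := (reach_ge d L).2.1
    have hreg : ∀ (x' : Site d) (κ' : Fin d), l1 (x' - (z + stencilOff L μ ν k)) ≤ (plaqWord μ ν).length →
        ‖((V x' κ' : 𝕄ˣ) : 𝕄) - 1‖ ≤ β := by
      intro x' κ' hx'
      refine hR x' κ' ?_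
      have h2 := l1_add_le (x' - (z + stencilOff L μ ν k)) (stencilOff L μ ν k)
      rw [show x' - (z + stencilOff L μ ν k) + stencilOff L μ ν k = x' - z by abel] at h2
      rw [hlen] at hx'; omega
    refine (norm_dhol_sub_asum_le_of_l1 hV ψ hβ _ _ hreg).trans ?_
    have hl := lnorm_le_region ψ (z := z) (q := z + stencilOff L μ ν k) (R := reach d L) (plaqWord μ ν)
      (by rw [add_sub_cancel_left, hlen]; omega)
    rw [hlen] at hl ⊢
    calc 2 * ((4 : ℕ) : ℝ) * β * lnorm ψ (z + stencilOff L μ ν k) (plaqWord μ ν)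
        ≤ 2 * ((4 : ℕ) : ℝ) * β * ((4 : ℕ) * dirL1 ψ (box (reach d L) z)) := mul_le_mul_of_nonneg_left hl (by positivity)
      _ = 32 * β * dirL1 ψ (box (reach d L) z) := by push_cast; ring
  refine (norm_sum_le _ _).trans ((Finset.sum_le_sum key).trans (le_of_eq ?_))
  rw [Finset.sum_const, card_stencilIdx, nsmul_eq_mul]
  have hL0 : (L : ℝ) ≠ 0 := by exact_mod_cast (by omega : L ≠ 0)
  push_cast
  field_simp
  ring

end

end Summit.QuantumFields.BalabanUV.T4Continuum.AveragingDeficitPlaqLin
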